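import Literature.Analysis.FluidPDE.Seregin2020AxisymmetricTypeII
import HarnessLib

/-!
# Seregin 2020, Lemma 2.2 (after Nazarov–Uraltseva 2012), atom L3.1′ part M2 (tools): the
# bookkeeping of Moser's iteration and the passage `L^{q_m} → L^∞`

Helper toward the stub `stub_seregin2020TypeII` of the crux `AxisymmetricKatoGlobal` (= the named
fact `Literature.Analysis.FluidPDE.Seregin2020_axisymmetricSingularPoint_typeII`, Seregin 2020,
Thm 2.1; reduced in the tree to Lemma 2.2 = N–U 2012 Lemma 4.2 in class 𝒱, whose piece L22-C is
reduced to three atoms; the atom L3.1′ `lemma22_smallSublevel_lowerBound` (N–U Lemma 3.1 + Cor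
3.1 (2) + Remark 6) is split into M1 `lemma22_moserStep` (one reverse-Hölder step) and M2 (the
iteration, seat c). This file holds the two data-free tools of M2:

* `ae_le_of_lintegral_rpow_le` — if `∫_E u^{q_m} ≤ W M^{q_m}` along exponents `q_m → ∞` then
  `u ≤ M` a.e. on `E` (Chebyshev);
* `moser_iterate_bound` — the arithmetic of N–U (3.6): from `I₀ ≤ W X₀` and
  `I_{m+1} ≤ G 8^{mA} W^{-2/3} I_m^{5/3}` along `q_{m+1} = (5/3) q_m`, `q₀ = 5/2`, the bound
  `I_m ≤ W (P X₀^{1/q₀})^{q_m}` with `P = exp(4 · (3/5)(log G + 4A log 8)/q₀)` (the series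
  `Σ (log G + jA log 8)/q_{j+1}` is dominated by a geometric one through `j ≤ 4 (5/4)^j`).

## References

* A. I. Nazarov, N. N. Uraltseva, St. Petersburg Math. J. 23 (2012) 93–115 = arXiv:1011.1888,
  proof of Lemma 3.1, (3.6) ("Iterating (3.6) we arrive at (3.1)"). [NazarovUraltseva2012]
* G. Seregin, Anal. Math. Phys. 10 (2020), Paper 46 = arXiv:2006.04140, Lemma 2.2. [Seregin2020]
-/

-- the problem directory repeats the summit name (D-0017); core's `dupNamespace` linter fires
set_option linter.dupNamespace false

noncomputable section

open MeasureTheory Set Function Filter Topology TopologicalSpace Metric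
open scoped NNReal ENNReal

namespace Summit.NavierStokesRegularity.NavierStokesRegularity.Theorems.AxisymmetricKatoGlobal.EulerScaling

/-! ### From `L^{q_m}` bounds to an a.e. bound -/

/-- **Chebyshev along exponents `q_m → ∞`.** If `u ≥ 0` is a.e.-measurable and
`∫_E u^{q_m} ≤ W · M^{q_m}` for all `m`, with `q_m → ∞`, `q_m ≥ 1`, `M > 0`, then
`u ≤ M` a.e. on `E`: for `δ > 0` the set `{u ≥ M(1+δ)}` has measure `≤ W (1+δ)^{-q_m} → 0`.
[cite: NazarovUraltseva2012, proof of Lemma 3.1 (the passage to (3.1))] -/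
theorem ae_le_of_lintegral_rpow_le {X : Type*} [MeasurableSpace X] {μ : Measure X}
    {u : X → ℝ} (hu : AEMeasurable u μ) {M W : ℝ} (hM : 0 < M)
    {q : ℕ → ℝ} (hq1 : ∀ m, 1 ≤ q m) (hq : Tendsto q atTop atTop)
    (h : ∀ m, ∫⁻ x, ENNReal.ofReal (u x ^ q m) ∂μ ≤ ENNReal.ofReal (W * M ^ q m)) :
    ∀ᵐ x ∂μ, u x ≤ M := by
  -- for each `n`, the set `{M (1 + 1/(n+1)) ≤ u}` is null
  have hnull : ∀ n : ℕ, μ {x | M * (1 + 1 / ((n : ℝ) + 1)) ≤ u x} = 0 := by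
    intro n
    set δ : ℝ := 1 / ((n : ℝ) + 1) with hδ
    have hδ0 : 0 < δ := by rw [hδ]; positivity
    set L : ℝ := M * (1 + δ) with hL
    have hL0 : 0 < L := by rw [hL]; positivity
    -- Chebyshev at exponent `q m`
    have hcheb : ∀ m, μ {x | L ≤ u x} ≤ ENNReal.ofReal (W * (1 + δ) ^ (-(q m))) := by
      intro m
      have hmeas : AEMeasurable (fun x => ENNReal.ofReal (u x ^ q m)) μ :=
        (hu.pow_const _).ennreal_ofReal
      have h1 := mul_meas_ge_le_lintegral₀ hmeas (ENNReal.ofReal (L ^ q m))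
      have hsub : {x | L ≤ u x} ⊆ {x | ENNReal.ofReal (L ^ q m) ≤ ENNReal.ofReal (u x ^ q m)} := by
        intro x hx
        exact ENNReal.ofReal_le_ofReal (Real.rpow_le_rpow hL0.le hx (by linarith [hq1 m]))
      have h2 : ENNReal.ofReal (L ^ q m) * μ {x | L ≤ u x} ≤ ENNReal.ofReal (W * M ^ q m) :=
        ((mul_le_mul_of_nonneg_left (measure_mono hsub) bot_le).trans h1).trans (h m)
      have hLq : 0 < L ^ q m := Real.rpow_pos_of_pos hL0 _
      have h3 : μ {x | L ≤ u x} ≤ ENNReal.ofReal (W * M ^ q m) / ENNReal.ofReal (L ^ q m) := by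
        rw [ENNReal.le_div_iff_mul_le (Or.inl ((ENNReal.ofReal_pos.2 hLq).ne'))
          (Or.inl ENNReal.ofReal_ne_top), mul_comm]
        exact h2
      refine h3.trans (le_of_eq ?_)
      rw [← ENNReal.ofReal_div_of_pos hLq]
      congr 1
      rw [hL, Real.mul_rpow hM.le (by linarith), Real.rpow_neg (by linarith)]
      field_simp
    -- the right-hand side tends to `0`
    have hlim : Tendsto (fun m => ENNReal.ofReal (W * (1 + δ) ^ (-(q m)))) atTop (𝓝 0) := by
      rw [← ENNReal.ofReal_zero]
      refine ENNReal.tendsto_ofReal ?_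
      have h1 : Tendsto (fun m => (1 + δ) ^ (-(q m))) atTop (𝓝 0) := by
        have hb : 1 < 1 + δ := by linarith
        have hlog : 0 < Real.log (1 + δ) := Real.log_pos hb
        have h2 : Tendsto (fun m => Real.exp (Real.log (1 + δ) * (-(q m)))) atTop (𝓝 0) := by
          refine Real.tendsto_exp_atBot.comp ?_
          have h3 : Tendsto (fun m => q m * Real.log (1 + δ)) atTop atTop := hq.atTop_mul_const hlog
          have h4 := tendsto_neg_atTop_atBot.comp h3
          refine h4.congr fun m => ?_
          simp only [Function.comp_apply]; ring
        refine h2.congr fun m => ?_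
        rw [Real.rpow_def_of_pos (by linarith)]
      simpa using h1.const_mul W
    have : μ {x | L ≤ u x} ≤ 0 := ge_of_tendsto' hlim hcheb
    exact le_antisymm this bot_le
  -- conclusion
  have hae : ∀ᵐ x ∂μ, ∀ n : ℕ, ¬ (M * (1 + 1 / ((n : ℝ) + 1)) ≤ u x) := by
    rw [ae_all_iff]
    intro n
    exact (measure_eq_zero_iff_ae_notMem.1 (hnull n))
  filter_upwards [hae] with x hx
  by_contra hlt
  push Not at hlt
  -- choose `n` with `M (1 + 1/(n+1)) ≤ u x`
  obtain ⟨n, hn⟩ := exists_nat_gt (M / (u x - M))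
  have hpos : 0 < u x - M := by linarith
  apply hx n
  have hn' : M / (u x - M) < (n : ℝ) + 1 := hn.trans (by linarith)
  rw [div_lt_iff₀ hpos] at hn'
  have : M * (1 / ((n : ℝ) + 1)) ≤ u x - M := by
    rw [mul_one_div, div_le_iff₀ (by positivity)]
    linarith
  linarith


/-! ### The arithmetic of the iteration -/

/-- `j ≤ 4 (5/4)^j` for all `j : ℕ`. [folklore] -/
theorem natCast_le_four_mul_pow (j : ℕ) : (j : ℝ) ≤ 4 * (5 / 4 : ℝ) ^ j := by
  induction j with
  | zero => norm_num
  | succ n ih =>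
    have h1 : (1 : ℝ) ≤ (5 / 4 : ℝ) ^ n := one_le_pow₀ (by norm_num)
    push_cast
    calc (n : ℝ) + 1 ≤ 4 * (5 / 4 : ℝ) ^ n + (5 / 4 : ℝ) ^ n := by linarith
      _ = 4 * (5 / 4 : ℝ) ^ (n + 1) := by ring

/-- `Σ_{j<m} (3/4)^j ≤ 4`. [folklore] -/
theorem sum_geom_three_quarters_le (m : ℕ) : ∑ j ∈ Finset.range m, (3 / 4 : ℝ) ^ j ≤ 4 := by
  have h : ∀ n : ℕ, ∑ j ∈ Finset.range n, (3 / 4 : ℝ) ^ j = 4 - 4 * (3 / 4 : ℝ) ^ n := by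
    intro n
    induction n with
    | zero => simp
    | succ n ih => rw [Finset.sum_range_succ, ih]; ring
  rw [h m]
  have : 0 ≤ (3 / 4 : ℝ) ^ m := by positivity
  linarith

/-- **The bookkeeping of Moser's iteration (N–U (3.6) ⇒ (3.1)).** Along the exponents
`q_m = (5/2)(5/3)^m`: if `I₀ ≤ W X₀` and `I_{m+1} ≤ G 8^{mA} W^{-2/3} I_m^{5/3}` (`W, X₀ > 0`,
`G ≥ 1`, `A ≥ 0`), then `I_m ≤ W (P X₀^{2/5})^{q_m}` for all `m`, with
`P = exp(4 · (3/5)(log G + 4A log 8)/(5/2))`: writing `I_m ≤ W exp(q_m y_m)` with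
`y_{m+1} = y_m + (log G + mA log 8)/q_{m+1}`, the increments are dominated by the geometric
series `c₂ (3/4)^j` (`j ≤ 4(5/4)^j`). [cite: NazarovUraltseva2012, proof of Lemma 3.1, (3.6) and "Iterating (3.6) we arrive at (3.1)"] -/
theorem moser_iterate_bound {I : ℕ → ℝ≥0∞} {W X₀ G A : ℝ} (hW : 0 < W) (hX₀ : 0 < X₀)
    (hG : 1 ≤ G) (hA : 0 ≤ A) (h0 : I 0 ≤ ENNReal.ofReal (W * X₀))
    (hstep : ∀ m : ℕ, I (m + 1) ≤
      ENNReal.ofReal (G * (8 : ℝ) ^ ((m : ℝ) * A) * W ^ (-(2 / 3 : ℝ))) * I m ^ (5 / 3 : ℝ)) :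
    ∀ m : ℕ, I m ≤ ENNReal.ofReal (W *
      (Real.exp (4 * (3 / 5 * (Real.log G + 4 * A * Real.log 8) / (5 / 2))) * X₀ ^ (1 / (5 / 2 : ℝ))) ^
        ((5 / 2 : ℝ) * (5 / 3 : ℝ) ^ m)) := by
  -- notation
  obtain ⟨q, hq⟩ : ∃ q : ℕ → ℝ, ∀ m, q m = 5 / 2 * (5 / 3 : ℝ) ^ m := ⟨_, fun _ => rfl⟩
  have hqpos : ∀ m, 0 < q m := fun m => by rw [hq]; positivity
  have hqsucc : ∀ m, q (m + 1) = 5 / 3 * q m := fun m => by rw [hq, hq, pow_succ]; ring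
  obtain ⟨c, hc⟩ : ∃ c : ℕ → ℝ, ∀ j, c j = (Real.log G + j * A * Real.log 8) / q (j + 1) := ⟨_, fun _ => rfl⟩
  obtain ⟨y, hy⟩ : ∃ y : ℕ → ℝ, ∀ m, y m = Real.log X₀ / q 0 + ∑ j ∈ Finset.range m, c j :=
    ⟨_, fun _ => rfl⟩
  have hlogG : 0 ≤ Real.log G := Real.log_nonneg hG
  have hlog8 : 0 < Real.log 8 := Real.log_pos (by norm_num)
  have hG0 : 0 < G := lt_of_lt_of_le one_pos hG
  -- the identity behind the step
  have hid : ∀ m, Real.exp (q (m + 1) * y (m + 1)) =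
      G * (8 : ℝ) ^ ((m : ℝ) * A) * Real.exp (q m * y m) ^ (5 / 3 : ℝ) := by
    intro m
    have e1 : q (m + 1) * y (m + 1) = 5 / 3 * (q m * y m) + (Real.log G + m * A * Real.log 8) := by
      rw [hy (m + 1), Finset.sum_range_succ, ← add_assoc, ← hy m, hc m, hqsucc]
      have := hqpos m
      field_simp
    rw [e1, Real.exp_add, Real.exp_add, ← Real.exp_mul, Real.exp_log hG0,
      Real.rpow_def_of_pos (by norm_num : (0 : ℝ) < 8)]
    ring_nf
  -- claim 1: the recursive bound
  have claim : ∀ m, I m ≤ ENNReal.ofReal (W * Real.exp (q m * y m)) := by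
    intro m
    induction m with
    | zero =>
      have e0 : q 0 * y 0 = Real.log X₀ := by
        rw [hy 0, Finset.sum_range_zero, add_zero, mul_div_cancel₀ _ (hqpos 0).ne']
      rw [e0, Real.exp_log hX₀]
      exact h0
    | succ m ih =>
      refine (hstep m).trans ?_
      have h1 : I m ^ (5 / 3 : ℝ) ≤ ENNReal.ofReal (W * Real.exp (q m * y m)) ^ (5 / 3 : ℝ) :=
        ENNReal.rpow_le_rpow ih (by norm_num)
      refine (mul_le_mul_of_nonneg_left h1 bot_le).trans (le_of_eq ?_)
      rw [ENNReal.ofReal_rpow_of_nonneg (by positivity) (by norm_num), ← ENNReal.ofReal_mul (by positivity),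
        hid m, Real.mul_rpow hW.le (Real.exp_pos _).le]
      congr 1
      have hW53 : W ^ (-(2 / 3 : ℝ)) * W ^ (5 / 3 : ℝ) = W := by
        rw [← Real.rpow_add hW]; norm_num
      calc G * (8 : ℝ) ^ ((m : ℝ) * A) * W ^ (-(2 / 3 : ℝ)) * (W ^ (5 / 3 : ℝ) * Real.exp (q m * y m) ^ (5 / 3 : ℝ))
          = (W ^ (-(2 / 3 : ℝ)) * W ^ (5 / 3 : ℝ)) * (G * (8 : ℝ) ^ ((m : ℝ) * A) * Real.exp (q m * y m) ^ (5 / 3 : ℝ)) := by ring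
        _ = W * (G * (8 : ℝ) ^ ((m : ℝ) * A) * Real.exp (q m * y m) ^ (5 / 3 : ℝ)) := by rw [hW53]
  -- claim 2: the increments are summable: `y m ≤ y 0 + 4 c₂`
  set c₂ : ℝ := 3 / 5 * (Real.log G + 4 * A * Real.log 8) / (5 / 2) with hc₂
  have hc₂0 : 0 ≤ c₂ := by rw [hc₂]; positivity
  have hcj : ∀ j : ℕ, c j ≤ c₂ * (3 / 4 : ℝ) ^ j := by
    intro j
    rw [hc, hq, div_le_iff₀ (by positivity)]
    have h1 : (j : ℝ) * A * Real.log 8 ≤ 4 * (5 / 4 : ℝ) ^ j * A * Real.log 8 := by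
      have := natCast_le_four_mul_pow j
      have hAl : 0 ≤ A * Real.log 8 := by positivity
      nlinarith
    have h2 : Real.log G ≤ Real.log G * (5 / 4 : ℝ) ^ j :=
      le_mul_of_one_le_right hlogG (one_le_pow₀ (by norm_num))
    have e : c₂ * (3 / 4 : ℝ) ^ j * (5 / 2 * (5 / 3 : ℝ) ^ (j + 1)) =
        (Real.log G + 4 * A * Real.log 8) * (5 / 4 : ℝ) ^ j := by
      rw [hc₂, pow_succ]
      have h34 : (3 / 4 : ℝ) ^ j * (5 / 3 : ℝ) ^ j = (5 / 4 : ℝ) ^ j := by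
        rw [← mul_pow]; norm_num
      calc 3 / 5 * (Real.log G + 4 * A * Real.log 8) / (5 / 2) * (3 / 4 : ℝ) ^ j * (5 / 2 * ((5 / 3 : ℝ) ^ j * (5 / 3)))
          = (Real.log G + 4 * A * Real.log 8) * ((3 / 4 : ℝ) ^ j * (5 / 3 : ℝ) ^ j) := by ring
        _ = _ := by rw [h34]
    rw [e]
    nlinarith
  have hysum : ∀ m, y m ≤ y 0 + 4 * c₂ := by
    intro m
    rw [hy m, hy 0, Finset.sum_range_zero, add_zero]
    have h1 : ∑ j ∈ Finset.range m, c j ≤ ∑ j ∈ Finset.range m, c₂ * (3 / 4 : ℝ) ^ j :=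
      Finset.sum_le_sum fun j _ => hcj j
    have h2 : ∑ j ∈ Finset.range m, c₂ * (3 / 4 : ℝ) ^ j ≤ c₂ * 4 := by
      rw [← Finset.mul_sum]
      exact mul_le_mul_of_nonneg_left (sum_geom_three_quarters_le m) hc₂0
    linarith
  -- conclusion
  intro m
  refine (claim m).trans (ENNReal.ofReal_le_ofReal (mul_le_mul_of_nonneg_left ?_ hW.le))
  have hP : Real.exp (q m * y m) ≤ Real.exp (q m * (y 0 + 4 * c₂)) :=
    Real.exp_le_exp.2 (mul_le_mul_of_nonneg_left (hysum m) (hqpos m).le)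
  refine hP.trans (le_of_eq ?_)
  rw [hy 0, Finset.sum_range_zero, add_zero, hq, hq 0, pow_zero, mul_one]
  rw [show (5 / 2 : ℝ) * (5 / 3 : ℝ) ^ m * (Real.log X₀ / (5 / 2) + 4 * c₂) =
      (Real.log X₀ * (1 / (5 / 2)) + 4 * c₂) * ((5 / 2 : ℝ) * (5 / 3 : ℝ) ^ m) by ring]
  rw [Real.exp_mul, Real.exp_add, ← Real.rpow_def_of_pos hX₀, hc₂]
  ring_nf

end Summit.NavierStokesRegularity.NavierStokesRegularity.Theorems.AxisymmetricKatoGlobal.EulerScaling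

end
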